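import Summits.CriticalPhenomena.PercolationContinuityZ3.Theorems.Transplant.SkelRootChainWF
import Summits.CriticalPhenomena.PercolationContinuityZ3.Theorems.Transplant.SkelPhiRootRoomsV
import Summits.CriticalPhenomena.PercolationContinuityZ3.Theorems.Transplant.SkelPhiRootChainNT
import Summits.CriticalPhenomena.PercolationContinuityZ3.Theorems.Transplant.SkelPhiRootBridgeGeom
import Summits.CriticalPhenomena.PercolationContinuityZ3.Theorems.Transplant.KNParaRootBridge
import Summits.CriticalPhenomena.PercolationContinuityZ3.Theorems.Transplant.SkelPhiWinChainS
import HarnessLib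

/-!
(R-40) T-TWIN (per-axis creep cap, cells `PCells2V`): mechanical port of the S original by hp-8 g42's registry renamedT/modmapT + `…S ↦ …T` on this file's own declarations; statements and proofs otherwise verbatim.
# N2 (frames-only node `SamePDropOfSkeletonFrm₁`, OPEN), (R) column after J13 / (R-36): THE ROOT LEG OF THE STAGGERED SCHEME FROM THE BRIDGE + A CORRIDOR —
# `Skelφ.rootChainF_of_bridgeV`, the (S0)/`RootOblTWF`-shape, STAGGERED-cells twin of N1's `Skelφ.rootOblTWAt_of_bridge` (SkelPhiRootChainN, p3-g9)

`RootOblTWF`-body at `du` for `⟨cellGeomSG₂bV G ψc P t Λ b₀, q, δc⟩` from: segment 1 = the BRIDGE (N1's one-step frame `B.bridgeFrame`, KNParaRootBridge, read through the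
signed root frame `rootFrame φ t σ`, SkelPhiRootBridgeGeom), segment 2 = ANY corridor frame `S₂` read through ANY 1-Lipschitz map `ψL` (for the K-G corridor of
record: `(kgCorrSched …).toFrame` and `ψL := runX φL c₁ nL hL 1`, SkelPhiRootLegBridgeKG), in the root's ball window graph under the root-seed law
`W0pin (edgesIn G A) U'`, rooms from CELL-FOOTPRINT bounds at the STAGGERED root cell (hp-8 g40's SkelPhiRootRoomsS: `mem_U0rootV_of_footprint`, `mem_rootQV_of_footprint`,
`mem_rootMbV_of_footprint` — the transverse bounds carry the creep `P.c du.1`, the arrival box is the small box `Mb b₀`), the clearances from the root frame's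
along-coordinate (`> kb` on every region, `≤ kb` on the seed: (R-F1)/(R-F2)), the hop as one link input — via `Skel.rootChainF_of_chain₂` (SkelRootChainWF).
WHY the bridge (J13, design owner p3-g16 2026-08-23T03:48:54Z): a one-corridor root leg from the pinned seed is vacuous — the first region always contains the hop's
seed (`ScheduleNP.encl`, `La = n`); N1's (L-R4) device is the one small-scale forced-kit step between the hop and the run.
What stays a hypothesis here (discharged by the successor / the values seat): the footprint bounds of the two frames' regions / last core / hop prism and the cross link,
the nonempty true targets, the per-segment forced-kit clauses (`hkits_bridgeFC` / `hkits_schedFC ∘ hrouteSW_kgCorr`) and counts under the root-seed law, the rim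
excesses, the numbers.
-- non-vacuity: discharged jointly by `SkelFrm1RootHoldsQ` (through `SkelPhiRootLegBridgeKG` at stmt-g20's root-corridor values with `q_root ≤ R′` and the bridge rows (R-F1)/(R-F2); pending).
builds on p205010 (kernel theorem, internal audit signed; external expert review pending) — nothing in this file uses p205010; nothing here is a claim about the open node.
Lane `prim-bschramm`, seat `prim-bschramm-p3` (gen 16; N2 design owner, (R) column owner); helper file (`--supports stmt-CriticalPhenomena-4575 --as helper`).
[cite: KozmaNitzan2024, §4 p. 27 (G₀), p. 28 ((32) at the root), Lemma 11 (pp. 22–23), Lemma 12 (pp. 23–25)] [cite: MartineauTassion2017, §3.2, §4.3]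
-/


noncomputable section

open MeasureTheory ProbabilityTheory
open scoped ENNReal Classical

namespace Summit.CriticalPhenomena.PercolationContinuityZ3.Theorems

namespace Transplant

namespace Skelφ

open Literature.Probability.Percolation Literature.Probability.LatticeModels SimpleGraph GadgetSystem ProbeHistory HSiteScheme Contour KNCells
open Literature.Probability.Percolation.KozmaNitzan.Cells (oth sgOf stepVec_apply_fst)
open KNCells.KSchA KNLevels ChainPlanar
open Literature.Barriers.CriticalPhenomena (graphBall mem_graphBall_self graphBall_mono)
open BoxProdZ2 (ConcRadiiG)
open Skel (winGraph)

variable {V : Type} [DecidableEq V] [Countable V] {G : SimpleGraph V} [G.LocallyFinite] {φ ψc ψL : V → Site 2}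

/-- **The root-world footprint condition at the STAGGERED root cell**: signed level `∈ [−5r∥ + 1, 25r∥ − 1]`, transverse `≤ 5r⊥ − 2 − c∥` in absolute value.
[cite: KozmaNitzan2024, §4 p. 26 (Q_v, E_{v,x})] -/
abbrev RootFootV (P : PCells2V) (du : MDir) (z : Site 2) : Prop := RootFootT P.toPCells2T du z

/-- **The arrival-box footprint condition (small box `Mb b₀` about the staggered child centre)**: level within `b₀∥ − 1` of `20r∥`, transverse within `b₀⊥ − 1` of `σ·c∥`.
[cite: KozmaNitzan2024, §4 p. 26 (M_v)] -/
abbrev TargetFootV (P : PCells2V) (b₀ : Fin 2 → ℕ) (du : MDir) (z : Site 2) : Prop := TargetFootT P.toPCells2T b₀ du z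

/-- **THE ROOT RESIDUE AT ONE DIRECTION FROM THE BRIDGE AND A LONG RUN** (see the module docstring for the roles of the hypotheses).
[cite: KozmaNitzan2024, §4 p. 28 ((32) at the root), Lemma 11 (pp. 22–23), Lemma 12 (pp. 23–25)] -/
theorem rootChainF_of_bridgeV (hlipφ : Lip G φ) (hlipc : Lip G ψc) (hwsc : WeakSteps G ψc) (hlipL : Lip G ψL)
    (P : PCells2V) (t : V) (Λ : ConcRadiiG) (b₀ : Fin 2 → ℕ) (q : unitInterval) (δc : ℝ) (du : MDir) {σ : ℤ} (hσ : σ = 1 ∨ σ = -1)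
    {Rπ : ℕ} (hRQ : Rπ + 1 ≤ Λ.rQ 0 0) (hRB : Rπ + 1 ≤ Λ.rB 0 0 du) (hRQ' : Rπ + 1 ≤ Λ.rQ 0 ((0 : Site 2) + stepVec du))
    (hRM : Rπ + 1 ≤ Λ.rM 0 ((0 : Site 2) + stepVec du))
    -- the pinned seed
    {A : Finset V} (htA : t ∈ A) (hAconn : ∀ a ∈ A, PathIn G (↑A : Set V) t a) (hAπ : ∀ a ∈ A, a ∈ graphBall G t Rπ)
    (hAfoot : ∀ a ∈ A, -(5 * (P.r du.1 : ℤ)) + 1 ≤ sgOf du * ψc a du.1 ∧ sgOf du * ψc a du.1 ≤ 5 * (P.r du.1 : ℤ) ∧ |ψc a (oth du.1)| ≤ 5 * (P.r (oth du.1) : ℤ) - 1)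
    {kb : ℕ} (hAk : ∀ a ∈ A, |rootFrame φ t σ a 0| ≤ kb)
    -- the two frames and the chain data
    (B : BridgePrm) (hB : BridgeOK B) (S₂ : SchedFrame) (P₁ P₂ : WinChainData V)
    (hPo₁ : P₁.o = t) (hPo₂ : P₂.o = t)
    (hPS₁ : P₁.Sfin = ((⟨cellGeomSG₂bV G ψc P t Λ b₀, q, δc⟩ : KSchA V ℕ).U0root du).filter fun y => y ∈ graphBall G t Rπ)
    (hPS₂ : P₂.Sfin = ((⟨cellGeomSG₂bV G ψc P t Λ b₀, q, δc⟩ : KSchA V ℕ).U0root du).filter fun y => y ∈ graphBall G t Rπ)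
    (hRim₁ : ∀ k, P₁.Rim k ⊆ (planarWindowWin (lip_rootFrame hlipφ t hσ) t Rπ).stepDF (B.bridgeFrame hB) k)
    (hRim₂ : ∀ k, P₂.Rim k ⊆ (planarWindowWin hlipL t Rπ).stepDF S₂ k)
    (hRl₁ : P₁.Rlev + 1 ≤ B.R') (hRl₂ : P₂.Rlev + 1 ≤ S₂.R') (hj₁ : P₁.j₁ ≤ P₁.Rlev) (hj₂ : P₂.j₁ ≤ P₂.Rlev)
    -- rooms: footprints of the regions and of the last core, clearances, nonempty targets, the cross link
    (hfoot₁ : ∀ w ∈ graphBall G t Rπ, rootFrame φ t σ w ∈ Finset.Icc B.regionLo B.regionHi → RootFootV P du (ψc w))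
    (hfoot₂ : ∀ k ≤ S₂.N, ∀ w ∈ graphBall G t Rπ, ψL w ∈ S₂.region k → RootFootV P du (ψc w))
    (hclear₁ : (kb : ℤ) < B.B₀lo 0 - B.R' - B.pr)
    (hclear₂ : ∀ k ≤ S₂.N, ∀ w ∈ graphBall G t Rπ, ψL w ∈ S₂.region k → (kb : ℤ) < rootFrame φ t σ w 0)
    (hTne₁ : (Win G (rootFrame φ t σ) t (Finset.Icc B.core1Lo B.core1Hi) Rπ).Nonempty)
    (hTne₂ : ∀ k ≤ S₂.N, (Win G ψL t (S₂.core (k + 1)) Rπ).Nonempty)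
    (hx : ∀ w ∈ graphBall G t Rπ, rootFrame φ t σ w ∈ Finset.Icc B.core1Lo B.core1Hi → ψL w ∈ S₂.core 0)
    (hlastf : ∀ w ∈ graphBall G t Rπ, ψL w ∈ S₂.core (S₂.N + 1) → TargetFootV P b₀ du (ψc w))
    -- the hop: one link input valid for `P_q`, its prism inside the ball with root-world footprints, its target inside the hop box
    {Δ' : ℕ} {δ : ℝ} {η : ℝ} {Qp T₀ : Finset V}
    (hlink : 1 - δ < (bondPercolation G q).real (linkIn (↑Qp : Set V) A T₀))
    (hQπ : ∀ w ∈ Qp, w ∈ graphBall G t Rπ) (hQfoot : ∀ w ∈ Qp, RootFootV P du (ψc w))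
    (hT₀ : ∀ w ∈ T₀, w ∈ graphBall G t Rπ ∧ rootFrame φ t σ w ∈ Finset.Icc B.B₀lo B.B₀hi)
    -- analytic inputs under the root-seed law (forced-kit clauses, counts, rim excesses) at accuracy `δ`
    (hcount₁ : 1 / (1 - (q : ℝ)) ^ (Δ' * P₁.N) ≤ δ * ((Finset.Icc P₁.j₀ P₁.j₁).card : ℝ))
    (hcount₂ : 1 / (1 - (q : ℝ)) ^ (Δ' * P₂.N) ≤ δ * ((Finset.Icc P₂.j₀ P₂.j₁).card : ℝ))
    (hkits₁ : ∀ k ≤ (B.bridgeFrame hB).N, ∀ j ∈ Finset.Icc P₁.j₀ P₁.j₁, ∃ (σk : SData V) (Sz : Finset V),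
      SHyp (P₁.stepLF (planarWindowWin (lip_rootFrame hlipφ t hσ) t Rπ) (B.bridgeFrame hB) k) j σk ∧ σk.N ≤ P₁.N ∧ (1 - (q : ℝ) ^ σk.sB) ^ σk.k ≤ δ ∧
      Sz ⊆ (planarWindowWin (lip_rootFrame hlipφ t hσ) t Rπ).stepDF (B.bridgeFrame hB) k ∧ (∀ x ∈ σk.K, σk.face x ⊆ Sz) ∧
      RelayClause (P₁.stepLF (planarWindowWin (lip_rootFrame hlipφ t hσ) t Rπ) (B.bridgeFrame hB) k) ((⟨cellGeomSG₂bV G ψc P t Λ b₀, q, δc⟩ : KSchA V ℕ).W0pin G (edgesIn G A)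
          (((⟨cellGeomSG₂bV G ψc P t Λ b₀, q, δc⟩ : KSchA V ℕ).U0root du).filter fun y => y ∈ graphBall G t Rπ)) j σk Sz
        (P₁.coreEF (planarWindowWin (lip_rootFrame hlipφ t hσ) t Rπ) (B.bridgeFrame hB) k) ((planarWindowWin (lip_rootFrame hlipφ t hσ) t Rπ).stepDF (B.bridgeFrame hB) k) δ)
    (hkits₂ : ∀ k ≤ S₂.N, ∀ j ∈ Finset.Icc P₂.j₀ P₂.j₁, ∃ (σk : SData V) (Sz : Finset V),
      SHyp (P₂.stepLF (planarWindowWin hlipL t Rπ) S₂ k) j σk ∧ σk.N ≤ P₂.N ∧ (1 - (q : ℝ) ^ σk.sB) ^ σk.k ≤ δ ∧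
      Sz ⊆ (planarWindowWin hlipL t Rπ).stepDF S₂ k ∧ (∀ x ∈ σk.K, σk.face x ⊆ Sz) ∧
      RelayClause (P₂.stepLF (planarWindowWin hlipL t Rπ) S₂ k) ((⟨cellGeomSG₂bV G ψc P t Λ b₀, q, δc⟩ : KSchA V ℕ).W0pin G (edgesIn G A)
          (((⟨cellGeomSG₂bV G ψc P t Λ b₀, q, δc⟩ : KSchA V ℕ).U0root du).filter fun y => y ∈ graphBall G t Rπ)) j σk Sz
        (P₂.coreEF (planarWindowWin hlipL t Rπ) S₂ k) ((planarWindowWin hlipL t Rπ).stepDF S₂ k) δ)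
    (hη : η ≤ δ / 2)
    (hexc₁ : ∀ k ≤ (B.bridgeFrame hB).N, (prodBernoulli ((⟨cellGeomSG₂bV G ψc P t Λ b₀, q, δc⟩ : KSchA V ℕ).W0pin G (edgesIn G A)
        (((⟨cellGeomSG₂bV G ψc P t Λ b₀, q, δc⟩ : KSchA V ℕ).U0root du).filter fun y => y ∈ graphBall G t Rπ))).real (⋃ t' ∈ P₁.Rim k, openConn t t') ≤ η)
    (hexc₂ : ∀ k ≤ S₂.N, (prodBernoulli ((⟨cellGeomSG₂bV G ψc P t Λ b₀, q, δc⟩ : KSchA V ℕ).W0pin G (edgesIn G A)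
        (((⟨cellGeomSG₂bV G ψc P t Λ b₀, q, δc⟩ : KSchA V ℕ).U0root du).filter fun y => y ∈ graphBall G t Rπ))).real (⋃ t' ∈ P₂.Rim k, openConn t t') ≤ η) :
    ∃ (c : V) (R₀ : ℕ) (W : Sym2 V → unitInterval) (s : Fin ((B.bridgeFrame hB).N + 1 + S₂.N + 1) → KNLevels.TStep (winGraph G c R₀))
      (T' : Fin ((B.bridgeFrame hB).N + 1 + S₂.N + 1) → Finset V) (η' : ℝ),
      (∀ T : Finset V, (prodBernoulli W).real (⋃ t' ∈ T, openConn t t') ≤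
        (prodBernoulli (pinW (KNLevels.lattW G q) ↑((⟨cellGeomSG₂bV G ψc P t Λ b₀, q, δc⟩ : KSchA V ℕ).U₀ G)
          ↑((⟨cellGeomSG₂bV G ψc P t Λ b₀, q, δc⟩ : KSchA V ℕ).U₀ G))).real
          (⋃ t' ∈ (↑T : Set V), openConnIn (↑((cellGeomSG₂bV G ψc P t Λ b₀).Q 0 0 ∪ (cellGeomSG₂bV G ψc P t Λ b₀).Ewv 0 0 du) : Set V) t t')) ∧
      (∀ i : Fin ((B.bridgeFrame hB).N + 1 + S₂.N + 1), (s i).L.o = t) ∧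
      (∀ i : Fin ((B.bridgeFrame hB).N + 1 + S₂.N), T' (Fin.castSucc i) ⊆ (s i.succ).L.X 0) ∧
      (∀ i : Fin ((B.bridgeFrame hB).N + 1 + S₂.N + 1), T' i ⊆ (s i).T) ∧
      (∀ i : Fin ((B.bridgeFrame hB).N + 1 + S₂.N + 1), (s i).KitsAtF W q Δ' δ) ∧ η' ≤ δ / 2 ∧
      (∀ i : Fin ((B.bridgeFrame hB).N + 1 + S₂.N + 1), (prodBernoulli W).real (⋃ t' ∈ (s i).T \ T' i, openConn t t') ≤ η') ∧
      1 - δ < (prodBernoulli W).real (s 0).L.reachB ∧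
      T' (Fin.last ((B.bridgeFrame hB).N + 1 + S₂.N)) ⊆ (cellGeomSG₂bV G ψc P t Λ b₀).M 0 ((0 : Site 2) + stepVec du) := by
  set S : KSchA V ℕ := ⟨cellGeomSG₂bV G ψc P t Λ b₀, q, δc⟩ with hSdef
  set 𝒲₁ := planarWindowWin (lip_rootFrame hlipφ t hσ) t Rπ with h𝒲₁
  set 𝒲₂ := planarWindowWin hlipL t Rπ with h𝒲₂
  set S₁ := B.bridgeFrame hB with hS₁
  have hroot : S.Γ.root = t := rfl
  -- footprints ⟹ the root world / the target box
  have hU : ∀ {w : V}, w ∈ graphBall G t Rπ → RootFootV P du (ψc w) → w ∈ (S.U0root du).filter fun y => y ∈ graphBall G t Rπ := by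
    intro w hw hf
    exact Finset.mem_filter.2 ⟨mem_U0rootV_of_footprint P t Λ b₀ q δc du hlipc hwsc hRQ hRB hRQ' hw hf.1 hf.2.1 hf.2.2, hw⟩
  -- the seed lies in the root cube
  have hAQ : A ⊆ S.Γ.Q S.Γ.a₀ 0 := by
    intro a ha
    obtain ⟨h1, h2, h3⟩ := hAfoot a ha
    exact mem_rootQV_of_footprint P t Λ b₀ du hlipc hwsc hRQ (hAπ a ha) h1 h2 h3
  -- regions of the bridge / long run: inside the world, off the seed
  have hDU₁ : ∀ k ≤ S₁.N, 𝒲₁.stepDF S₁ k ⊆ (S.U0root du).filter fun y => y ∈ graphBall G t Rπ := by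
    intro k hk w hw
    obtain rfl : k = 0 := Nat.le_zero.1 hk
    change w ∈ Win G (rootFrame φ t σ) t (S₁.region 0) Rπ at hw
    rw [mem_Win] at hw
    exact hU hw.1 (hfoot₁ w hw.1 (by simpa [hS₁] using hw.2))
  have hDU₂ : ∀ k ≤ S₂.N, 𝒲₂.stepDF S₂ k ⊆ (S.U0root du).filter fun y => y ∈ graphBall G t Rπ := by
    intro k hk w hw
    change w ∈ Win G ψL t (S₂.region k) Rπ at hw
    rw [mem_Win] at hw
    exact hU hw.1 (hfoot₂ k hk w hw.1 hw.2)
  have hDA₁ : ∀ k ≤ S₁.N, Disjoint (𝒲₁.stepDF S₁ k) A := by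
    intro k hk
    obtain rfl : k = 0 := Nat.le_zero.1 hk
    change Disjoint (Win G (rootFrame φ t σ) t (S₁.region 0) Rπ) A
    refine Finset.disjoint_left.2 fun w hw hwA => ?_
    rw [mem_Win] at hw
    have h1 : B.B₀lo 0 - B.R' - B.pr ≤ rootFrame φ t σ w 0 := BridgePrm.le_of_mem_region (by simpa [hS₁] using hw.2) 0
    have h2 := (abs_le.1 (hAk w hwA)).2
    linarith
  have hDA₂ : ∀ k ≤ S₂.N, Disjoint (𝒲₂.stepDF S₂ k) A := by
    intro k hk
    change Disjoint (Win G ψL t (S₂.region k) Rπ) A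
    refine Finset.disjoint_left.2 fun w hw hwA => ?_
    rw [mem_Win] at hw
    have h1 := hclear₂ k hk w hw.1 hw.2
    have h2 := (abs_le.1 (hAk w hwA)).2
    linarith
  -- nonempty true targets
  have hTne₁' : ∀ k ≤ S₁.N, (𝒲₁.coreTF S₁ k).Nonempty := by
    intro k hk
    obtain rfl : k = 0 := Nat.le_zero.1 hk
    change (Win G (rootFrame φ t σ) t (S₁.core (0 + 1)) Rπ).Nonempty
    simpa [hS₁] using hTne₁
  have hTne₂' : ∀ k ≤ S₂.N, (𝒲₂.coreTF S₂ k).Nonempty := fun k hk => hTne₂ k hk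
  -- the cross link and the last core
  have hx' : 𝒲₁.coreTF S₁ S₁.N ⊆ 𝒲₂.W (S₂.core 0) := by
    intro w hw
    change w ∈ Win G (rootFrame φ t σ) t (S₁.core (S₁.N + 1)) Rπ at hw
    change w ∈ Win G ψL t (S₂.core 0) Rπ
    rw [mem_Win] at hw ⊢
    exact ⟨hw.1, hx w hw.1 (by simpa [hS₁] using hw.2)⟩
  have hlast : 𝒲₂.coreTF S₂ S₂.N ⊆ S.Γ.M S.Γ.a₀ ((0 : Site 2) + stepVec du) := by
    intro w hw
    change w ∈ Win G ψL t (S₂.core (S₂.N + 1)) Rπ at hw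
    rw [mem_Win] at hw
    obtain ⟨ha, hb⟩ := hlastf w hw.1 hw.2
    exact mem_rootMbV_of_footprint P t Λ b₀ du hlipc hwsc hRM hw.1 ha hb
  -- the hop's prism inside the world, its target inside the first level
  have hQU : Qp ⊆ (S.U0root du).filter fun y => y ∈ graphBall G t Rπ := fun w hw => hU (hQπ w hw) (hQfoot w hw)
  have hT₀' : T₀ ⊆ 𝒲₁.W (S₁.core 0) := by
    intro w hw
    obtain ⟨hπ, hbox⟩ := hT₀ w hw
    change w ∈ Win G (rootFrame φ t σ) t (S₁.core 0) Rπ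
    rw [mem_Win]
    exact ⟨hπ, by simpa [hS₁] using hbox⟩
  -- assemble
  exact Skel.rootChainF_of_chain₂ (S := S) hAQ hAπ htA hAconn 𝒲₁ 𝒲₂ S₁ S₂ P₁ P₂ hPo₁ hPo₂ hPS₁ hPS₂ hRim₁ hRim₂ hRl₁ hRl₂ hj₁ hj₂
    hTne₁' hTne₂' hDU₁ hDU₂ hDA₁ hDA₂ hx' hlast hlink hQU hT₀' hcount₁ hcount₂ hkits₁ hkits₂ hη
    hexc₁ hexc₂

end Skelφ

end Transplant

end Summit.CriticalPhenomena.PercolationContinuityZ3.Theorems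

end
-- build-touch 2026-08-25T06:06:10Z T1-A (lead g18): re-land of p391587, declarations byte-identical
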